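import Literature.Probability.LatticeModels.InfraredBoundProofs
import Literature.Probability.LatticeModels.FreeStateLimit
import Literature.Probability.LatticeModels.ONModelSpecification
import HarnessLib

/-!
# Reflection positivity of free-boundary Ising volumes seen from the infinite lattice, and of their limits

Theorem-only file (no definitions, no named facts). The tree proves reflection positivity of the
nearest-neighbour Ising measure with free boundary condition on a FINITE graph carrying an
involutive automorphism `θ` (`isingMeasure_univ_free_reflectionPositive` for reflections
"through sites", `isingMeasure_univ_free_reflectionPositive_of_cross` for reflections "through
bonds"; Fröhlich–Israel–Lieb–Simon 1978 §2, Friedli–Velenik 2017 Lemma 10.8 / Example 10.9,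
Biskup 2009 Lemma 5.3), and the transport of free expectations along graph embeddings
(`isingExpect_free_map`, `IsingTransport.lean`). Here these are combined into the form in which
reflection positivity is inherited by infinite-volume states:

* `isingExpect_free_reflect_mul_self_nonneg` (sites) and `…_of_cross` (bonds) — for a locally
  finite graph `G` on `V`, an involutive automorphism `θ` of `G`, a finite volume `Λ` stable under
  `θ`, a half `P ⊆ V` in the geometric position of FILS/Biskup relative to `θ`, and every bounded
  measurable real observable `F` depending only on the spins in `P`:
  `0 ≤ ⟨(F ∘ θ*) · F⟩^∅_{Λ;β,h}` — the free finite-volume Gibbs measure of `Λ`, viewed on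
  `{±1}^V`, is reflection positive on `P`-local observables (proof: it is the free measure of the
  induced finite graph on `Λ` transported along `Λ ↪ V`, and `F` pulls back to a `P ∩ Λ`-local
  observable of that graph);
* `integral_reflect_mul_self_nonneg_of_tendsto_isingCorr` — if the free correlations of a
  sequence of volumes `Λ_n` converge to the correlations of a probability measure `μ`
  (`⟨σ_B⟩^∅_{Λ_n} → ∫ σ_B dμ` for all finite `B`) and `0 ≤ ⟨(F ∘ θ*) F⟩^∅_{Λ_n}` eventually, then
  `0 ≤ ∫ (F ∘ θ*) F dμ` for the LOCAL observable `F` (expand the local observable `(F ∘ θ*) F` in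
  spin products, Friedli–Velenik Lemma 3.19 = `exists_sum_spinProduct_of_dependsOn`);
* `integral_reflect_mul_self_nonneg_of_symmetric_volumes` (sites) / `…_of_cross` (bonds) — the two
  combined: limits of free states along `θ`-symmetric volumes are reflection positive on local
  observables. Together with `isReflectionPositive_of_local` (`ReflectionPositivityExtension.lean`)
  this yields `IsReflectionPositive` for such limit states (used for the Ising free/plus state in
  `PlusStateReflectionPositivity.lean`).

## References

* J. Fröhlich, R. Israel, E. H. Lieb, B. Simon, Comm. Math. Phys. 62 (1978) 1–34, §2. [FILS1978]
* S. Friedli, Y. Velenik, *Statistical Mechanics of Lattice Systems* (2017), Lemma 3.19,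
  Lemma 10.8, Example 10.9. [FriedliVelenik2017]
* M. Biskup, LNM 1970 (2009), §5.1, Lemma 5.3 and the remark on weak limits. [Biskup2009]
-/

noncomputable section

open MeasureTheory Filter Finset
open scoped Topology

namespace Literature.Probability.LatticeModels

/-! ### Configurations transported along the inclusion of a finite volume -/

section Subtype

variable {V : Type*} (Λ : Finset V)

/-- Transport along the inclusion `Λ ↪ V`: the configuration is `σ` on `Λ` and `1` outside. [folklore] -/
theorem extendAlong_subtype_apply [DecidableEq V] (σ : SpinConfig ↥Λ) (y : V) :
    SpinConfig.extendAlong (Function.Embedding.subtype (· ∈ Λ)) σ y =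
      if hy : y ∈ Λ then σ ⟨y, hy⟩ else 1 := by
  by_cases hy : y ∈ Λ
  · rw [dif_pos hy]
    exact SpinConfig.extendAlong_apply (Function.Embedding.subtype (· ∈ Λ)) σ ⟨y, hy⟩
  · rw [dif_neg hy]
    exact SpinConfig.extendAlong_apply_of_forall_ne _ σ fun x hx => hy (hx ▸ x.2)

/-- The inclusion `Λ ↪ V` maps the whole finite vertex set onto `Λ`. [folklore] -/
theorem univ_map_embedding_subtype : (Finset.univ : Finset ↥Λ).map (Function.Embedding.subtype (· ∈ Λ)) = Λ := by
  ext y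
  simp only [Finset.mem_map, Finset.mem_univ, true_and, Function.Embedding.coe_subtype, Subtype.exists,
    exists_prop, exists_eq_right]

variable {Λ}

/-- A reflection `θ` of `V` preserving `Λ` commutes with transport along `Λ ↪ V`:
`(extendAlong σ) ∘ θ = extendAlong (σ ∘ θ|_Λ)`. [folklore] -/
theorem configReflect_extendAlong_subtype [DecidableEq V] (θ : V ≃ V) (hΛ : ∀ x, x ∈ Λ ↔ θ x ∈ Λ)
    (σ : SpinConfig ↥Λ) :
    configReflect θ (SpinConfig.extendAlong (Function.Embedding.subtype (· ∈ Λ)) σ) =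
      SpinConfig.extendAlong (Function.Embedding.subtype (· ∈ Λ)) (configReflect (θ.subtypeEquiv hΛ) σ) := by
  funext y
  rw [configReflect_apply, extendAlong_subtype_apply, extendAlong_subtype_apply]
  by_cases hy : y ∈ Λ
  · have hθy : θ y ∈ Λ := (hΛ y).1 hy
    rw [dif_pos hθy, dif_pos hy, configReflect_apply]
    rfl
  · have hθy : θ y ∉ Λ := fun h => hy ((hΛ y).2 h)
    rw [dif_neg hθy, dif_neg hy]

/-- An observable depending only on the spins in `P` pulls back, along `Λ ↪ V`, to an observable of
the induced volume depending only on the spins in `P ∩ Λ`. [folklore] -/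
theorem dependsOn_comp_extendAlong_subtype [DecidableEq V] {P : Set V} {F : SpinConfig V → ℝ}
    (hFP : DependsOn F P) :
    DependsOn (fun σ : SpinConfig ↥Λ => F (SpinConfig.extendAlong (Function.Embedding.subtype (· ∈ Λ)) σ))
      {a : ↥Λ | (a : V) ∈ P} := by
  intro σ τ hστ
  refine hFP fun y hy => ?_
  rw [extendAlong_subtype_apply, extendAlong_subtype_apply]
  by_cases hyΛ : y ∈ Λ
  · rw [dif_pos hyΛ, dif_pos hyΛ]
    exact hστ ⟨y, hyΛ⟩ hy
  · rw [dif_neg hyΛ, dif_neg hyΛ]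

end Subtype

/-! ### Reflection positivity of free finite volumes, seen on `{±1}^V` -/

section FiniteVolume

variable {V : Type*} [DecidableEq V] (G : SimpleGraph V) [G.LocallyFinite] [DecidableRel G.Adj]

/-- **Transport of the quadratic RP form to the induced graph.** For a finite volume `Λ ⊆ V` stable
under the bijection `θ` and a measurable real observable `F`, the free expectation
`⟨(F ∘ θ*) F⟩^∅_{Λ;β,h}` on `{±1}^V` equals the free expectation, on the finite graph induced by
`G` on `Λ`, of `(F' ∘ θ'*) F'` with `F' = F ∘ extendAlong` and `θ' = θ|_Λ` (Friedli–Velenik 2017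
§3.1: the free Hamiltonian involves only the edges inside `Λ`; the tree's `isingExpect_free_map`). [cite: FriedliVelenik2017, §3.1, Def. 3.1] -/
theorem isingExpect_free_reflect_mul_self_eq_induced (θ : V ≃ V) {Λ : Finset V}
    (hΛ : ∀ x, x ∈ Λ ↔ θ x ∈ Λ) (β h : ℝ) {F : SpinConfig V → ℝ} (hFm : Measurable F) :
    isingExpect G Λ β h .free (fun τ => F (configReflect θ τ) * F τ) =
      isingExpect (G.comap (Function.Embedding.subtype (· ∈ Λ))) Finset.univ β h .free
        (fun σ => F (SpinConfig.extendAlong (Function.Embedding.subtype (· ∈ Λ))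
            (configReflect (θ.subtypeEquiv hΛ) σ)) *
          F (SpinConfig.extendAlong (Function.Embedding.subtype (· ∈ Λ)) σ)) := by
  have hf : Measurable fun τ => F (configReflect θ τ) * F τ :=
    (hFm.comp (measurable_configReflect θ)).mul hFm
  have ht := isingExpect_free_map (G := G.comap (Function.Embedding.subtype (· ∈ Λ))) (G' := G)
    (Function.Embedding.subtype (· ∈ Λ)) (Λ := Finset.univ) (fun a _ b _ => Iff.rfl) β h hf
  rw [univ_map_embedding_subtype] at ht
  rw [ht]
  congr 1
  funext σ
  simp only [configReflect_extendAlong_subtype θ hΛ σ]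

/-- **Free finite volumes are reflection positive through sites, on the infinite configuration
space.** Let `θ` be an involutive automorphism of the locally finite graph `G`, `Λ` a finite
volume stable under `θ`, and `P ⊆ V` a half in the position of a reflection THROUGH SITES:
`V = P ∪ θP`, `θ = id` on `P ∩ θP`, and every edge lies in `P` or in `θP`. Then for every bounded
measurable real observable `F` of `{±1}^V` depending only on the spins in `P`,
`0 ≤ ⟨(F ∘ θ*) · F⟩^∅_{Λ;β,h}` for all real `β, h` (Friedli–Velenik 2017 Lemma 10.8 /
Example 10.9 and FILS 1978 §2 on the finite graph induced on `Λ` — the tree's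
`isingMeasure_univ_free_reflectionPositive` — transported along `Λ ↪ V`). [cite: FriedliVelenik2017, Lemma 10.8] -/
theorem isingExpect_free_reflect_mul_self_nonneg (θ : V ≃ V) (hθ : Function.Involutive θ)
    (hθG : ∀ x y, G.Adj x y → G.Adj (θ x) (θ y)) {Λ : Finset V} (hΛ : ∀ x, x ∈ Λ ↔ θ x ∈ Λ)
    {P : Set V} (H1 : ∀ x, x ∈ P ∨ θ x ∈ P) (H2 : ∀ x ∈ P, θ x ∈ P → θ x = x)
    (H3 : ∀ x y, G.Adj x y → (x ∈ P ∧ y ∈ P) ∨ (θ x ∈ P ∧ θ y ∈ P)) (β h : ℝ)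
    {F : SpinConfig V → ℝ} (hFm : Measurable F) (hFP : DependsOn F P) (hFb : ∃ C, ∀ σ, |F σ| ≤ C) :
    0 ≤ isingExpect G Λ β h .free (fun τ => F (configReflect θ τ) * F τ) := by
  classical
  obtain ⟨C, hC⟩ := hFb
  set φ : ↥Λ ↪ V := Function.Embedding.subtype (· ∈ Λ) with hφ
  set θ' : ↥Λ ≃ ↥Λ := θ.subtypeEquiv hΛ with hθ'
  set P' : Set ↥Λ := {a : ↥Λ | (a : V) ∈ P} with hP'
  have hθ'i : Function.Involutive θ' := fun a => Subtype.ext (hθ a)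
  have hRP : IsReflectionPositive (isingMeasure (G.comap φ) Finset.univ β h .free) θ' P' :=
    isingMeasure_univ_free_reflectionPositive (G.comap φ) θ' P' hθ'i
      (fun a b hab => hθG _ _ hab) (fun a => H1 a) (fun a ha hθa => Subtype.ext (H2 _ ha hθa))
      (fun a b hab => H3 _ _ hab) β h
  set F' : SpinConfig ↥Λ → ℝ := fun σ => F (SpinConfig.extendAlong φ σ) with hF'
  have hF'P : DependsOn F' P' := dependsOn_comp_extendAlong_subtype hFP
  have hF'm : Measurable[positiveEvents P'] F' :=
    (hFm.comp (SpinConfig.measurable_extendAlong φ)).measurable_cylinderEvents_of_dependsOn hF'P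
  have h0 := hRP.real F' hF'm ⟨C, fun σ => by rw [Real.norm_eq_abs]; exact hC _⟩
  rw [isingExpect_free_reflect_mul_self_eq_induced G θ hΛ β h hFm]
  exact h0

/-- **Free finite volumes are reflection positive through bonds, on the infinite configuration
space.** As `isingExpect_free_reflect_mul_self_nonneg`, for a half `P` in the position of a
reflection THROUGH BONDS: `P` and `θP` partition `V` and every edge leaving `P` joins `x` to `θ x`;
here the coupling must be ferromagnetic, `0 ≤ β` (FILS 1978 §2, n.n. ferromagnets; Friedli–Velenik
2017 Lemma 10.8; the tree's `isingMeasure_univ_free_reflectionPositive_of_cross`). [cite: FriedliVelenik2017, Lemma 10.8] -/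
theorem isingExpect_free_reflect_mul_self_nonneg_of_cross (θ : V ≃ V) (hθ : Function.Involutive θ)
    (hθG : ∀ x y, G.Adj x y → G.Adj (θ x) (θ y)) {Λ : Finset V} (hΛ : ∀ x, x ∈ Λ ↔ θ x ∈ Λ)
    {P : Set V} (hP : ∀ x, x ∈ P ↔ θ x ∉ P) (hcross : ∀ x y, G.Adj x y → x ∈ P → y ∉ P → y = θ x)
    {β : ℝ} (hβ : 0 ≤ β) (h : ℝ)
    {F : SpinConfig V → ℝ} (hFm : Measurable F) (hFP : DependsOn F P) (hFb : ∃ C, ∀ σ, |F σ| ≤ C) :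
    0 ≤ isingExpect G Λ β h .free (fun τ => F (configReflect θ τ) * F τ) := by
  classical
  obtain ⟨C, hC⟩ := hFb
  set φ : ↥Λ ↪ V := Function.Embedding.subtype (· ∈ Λ) with hφ
  set θ' : ↥Λ ≃ ↥Λ := θ.subtypeEquiv hΛ with hθ'
  set P' : Set ↥Λ := {a : ↥Λ | (a : V) ∈ P} with hP'
  have hθ'i : Function.Involutive θ' := fun a => Subtype.ext (hθ a)
  have hRP : IsReflectionPositive (isingMeasure (G.comap φ) Finset.univ β h .free) θ' P' :=
    isingMeasure_univ_free_reflectionPositive_of_cross (G.comap φ) θ' P' hθ'i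
      (fun a b hab => hθG _ _ hab) (fun a => hP a)
      (fun a b hab ha hb => Subtype.ext (hcross _ _ hab ha hb)) hβ h
  set F' : SpinConfig ↥Λ → ℝ := fun σ => F (SpinConfig.extendAlong φ σ) with hF'
  have hF'P : DependsOn F' P' := dependsOn_comp_extendAlong_subtype hFP
  have hF'm : Measurable[positiveEvents P'] F' :=
    (hFm.comp (SpinConfig.measurable_extendAlong φ)).measurable_cylinderEvents_of_dependsOn hF'P
  have h0 := hRP.real F' hF'm ⟨C, fun σ => by rw [Real.norm_eq_abs]; exact hC _⟩
  rw [isingExpect_free_reflect_mul_self_eq_induced G θ hΛ β h hFm]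
  exact h0

end FiniteVolume

/-! ### Passage to limit states on local observables -/

section Limit

variable {V : Type*} [DecidableEq V] (G : SimpleGraph V) [G.LocallyFinite] [DecidableRel G.Adj]

omit [DecidableRel G.Adj] in
/-- The free expectation of a finite linear combination of spin products is the corresponding
combination of free correlations (linearity of the integral). [folklore] -/
theorem isingExpect_sum_mul_spinProduct {ι : Type*} (s : Finset ι) (c : ι → ℝ) (B : ι → Finset V)
    (Λ : Finset V) (β h : ℝ) (bc : BoundaryCondition V) :
    isingExpect G Λ β h bc (fun σ => ∑ i ∈ s, c i * spinProduct (B i) σ) =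
      ∑ i ∈ s, c i * isingCorr G Λ β h bc (B i) := by
  unfold isingExpect isingCorr isingExpect
  rw [integral_finsetSum _ fun i _ => (integrable_spinProduct _ (B i)).const_mul (c i)]
  refine Finset.sum_congr rfl fun i _ => ?_
  exact integral_const_mul _ _

omit [DecidableEq V] in
/-- The expectation of a finite linear combination of spin products is the corresponding
combination of correlations (linearity of the integral). [folklore] -/
theorem integral_sum_mul_spinProduct {ι : Type*} (s : Finset ι) (c : ι → ℝ) (B : ι → Finset V)
    (μ : Measure (SpinConfig V)) [IsFiniteMeasure μ] :
    ∫ σ, ∑ i ∈ s, c i * spinProduct (B i) σ ∂μ = ∑ i ∈ s, c i * spinCorr μ (B i) := by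
  rw [integral_finsetSum _ fun i _ => (integrable_spinProduct _ (B i)).const_mul (c i)]
  refine Finset.sum_congr rfl fun i _ => ?_
  exact integral_const_mul _ _

/-- The quadratic RP observable `(F ∘ θ*) · F` of a local observable `F` is local. [folklore] -/
theorem dependsOn_reflect_mul_self (θ : V ≃ V) {F : SpinConfig V → ℝ} {W : Finset V}
    (hFW : DependsOn F (↑W : Set V)) :
    DependsOn (fun τ => F (configReflect θ τ) * F τ) (↑(W ∪ W.image θ) : Set V) := by
  intro σ τ hστ
  simp only [Finset.coe_union, Finset.coe_image] at hστ
  have h1 : F (configReflect θ σ) = F (configReflect θ τ) :=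
    hFW fun x hx => by
      simp only [configReflect_apply]
      exact hστ (θ x) (Or.inr ⟨x, hx, rfl⟩)
  have h2 : F σ = F τ := hFW fun x hx => hστ x (Or.inl hx)
  simp only [h1, h2]

omit [DecidableRel G.Adj] in
/-- **Reflection positivity on local observables passes to limit states.** Let the free
correlations of a sequence of finite volumes `Λ_n` converge to the correlations of a probability
measure `μ` on `{±1}^V`, `⟨σ_B⟩^∅_{Λ_n;β,h} → ∫ σ_B dμ` for every finite `B`, and let `F` be a
measurable real observable depending only on the spins in a finite set `W`. If
`0 ≤ ⟨(F ∘ θ*) F⟩^∅_{Λ_n;β,h}` for all large `n`, then `0 ≤ ∫ (F ∘ θ*) F dμ`. (Expand the local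
observable `(F ∘ θ*) F` in spin products, Friedli–Velenik 2017 Lemma 3.19; "reflection positivity
survives weak limits", Biskup 2009 §5.) [cite: FriedliVelenik2017, Lemma 3.19] -/
theorem integral_reflect_mul_self_nonneg_of_tendsto_isingCorr {μ : Measure (SpinConfig V)}
    [IsProbabilityMeasure μ] (θ : V ≃ V) {β h : ℝ} (Λs : ℕ → Finset V)
    (hlim : ∀ B : Finset V,
      Tendsto (fun n => isingCorr G (Λs n) β h .free B) atTop (𝓝 (spinCorr μ B)))
    {F : SpinConfig V → ℝ} {W : Finset V} (hFW : DependsOn F (↑W : Set V))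
    (hpos : ∀ᶠ n in atTop, 0 ≤ isingExpect G (Λs n) β h .free (fun τ => F (configReflect θ τ) * F τ)) :
    0 ≤ ∫ τ, F (configReflect θ τ) * F τ ∂μ := by
  classical
  set D : Finset V := W ∪ W.image θ with hD
  obtain ⟨c, hc⟩ := exists_sum_spinProduct_of_dependsOn D (dependsOn_reflect_mul_self θ hFW)
  have hfun : (fun τ => F (configReflect θ τ) * F τ) =
      fun τ => ∑ B : Finset ↥D, c B * spinProduct (B.map (Function.Embedding.subtype (· ∈ D))) τ :=
    funext hc
  have hT : Tendsto (fun n => isingExpect G (Λs n) β h .free (fun τ => F (configReflect θ τ) * F τ)) atTop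
      (𝓝 (∫ τ, F (configReflect θ τ) * F τ ∂μ)) := by
    rw [hfun]
    simp_rw [isingExpect_sum_mul_spinProduct, integral_sum_mul_spinProduct]
    exact tendsto_finsetSum _ fun B _ => (hlim _).const_mul _
  exact ge_of_tendsto hT hpos

/-- **Limits of free states along symmetric volumes are reflection positive on local observables
(reflections through sites).** In the setting of `isingExpect_free_reflect_mul_self_nonneg`
(involutive automorphism `θ`, half `P` through sites), if the free correlations along a sequence of
`θ`-stable finite volumes `Λ_n` converge to the correlations of a probability measure `μ`, then
`0 ≤ ∫ (F ∘ θ*) F dμ` for every measurable real `F` depending on finitely many spins in `P`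
(FILS 1978 §2; Biskup 2009 §5, RP of infinite-volume limits of RP states). [cite: FILS1978, §2] -/
theorem integral_reflect_mul_self_nonneg_of_symmetric_volumes {μ : Measure (SpinConfig V)}
    [IsProbabilityMeasure μ] (θ : V ≃ V) (hθ : Function.Involutive θ)
    (hθG : ∀ x y, G.Adj x y → G.Adj (θ x) (θ y)) {P : Set V} (H1 : ∀ x, x ∈ P ∨ θ x ∈ P)
    (H2 : ∀ x ∈ P, θ x ∈ P → θ x = x) (H3 : ∀ x y, G.Adj x y → (x ∈ P ∧ y ∈ P) ∨ (θ x ∈ P ∧ θ y ∈ P))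
    {β h : ℝ} (Λs : ℕ → Finset V) (hΛs : ∀ n x, x ∈ Λs n ↔ θ x ∈ Λs n)
    (hlim : ∀ B : Finset V,
      Tendsto (fun n => isingCorr G (Λs n) β h .free B) atTop (𝓝 (spinCorr μ B)))
    (W : Finset V) (hWP : (↑W : Set V) ⊆ P) (F : SpinConfig V → ℝ) (hFm : Measurable F)
    (hFW : DependsOn F (↑W : Set V)) :
    0 ≤ ∫ τ, F (configReflect θ τ) * F τ ∂μ := by
  have hFb : ∃ C, ∀ σ, |F σ| ≤ C := by
    classical
    let e : (↥W → ℤˣ) → SpinConfig V := fun η x => if hx : x ∈ W then η ⟨x, hx⟩ else 1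
    obtain ⟨C, hC⟩ := Finite.exists_le fun η : ↥W → ℤˣ => |F (e η)|
    refine ⟨C, fun σ => ?_⟩
    have hσ : F σ = F (e fun x => σ x) := hFW fun x hx => by simp [e, Finset.mem_coe.1 hx]
    rw [hσ]
    exact hC fun x => σ ↑x
  refine integral_reflect_mul_self_nonneg_of_tendsto_isingCorr G θ Λs hlim hFW
    (Eventually.of_forall fun n => ?_)
  exact isingExpect_free_reflect_mul_self_nonneg G θ hθ hθG (hΛs n) H1 H2 H3 β h hFm
    (hFW.mono hWP) hFb

/-- **Limits of free states along symmetric volumes are reflection positive on local observables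
(reflections through bonds, `β ≥ 0`).** Bond version of
`integral_reflect_mul_self_nonneg_of_symmetric_volumes` (FILS 1978 §2, n.n. ferromagnets;
Biskup 2009 §5). [cite: FILS1978, §2] -/
theorem integral_reflect_mul_self_nonneg_of_symmetric_volumes_of_cross {μ : Measure (SpinConfig V)}
    [IsProbabilityMeasure μ] (θ : V ≃ V) (hθ : Function.Involutive θ)
    (hθG : ∀ x y, G.Adj x y → G.Adj (θ x) (θ y)) {P : Set V} (hP : ∀ x, x ∈ P ↔ θ x ∉ P)
    (hcross : ∀ x y, G.Adj x y → x ∈ P → y ∉ P → y = θ x)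
    {β : ℝ} (hβ : 0 ≤ β) {h : ℝ} (Λs : ℕ → Finset V) (hΛs : ∀ n x, x ∈ Λs n ↔ θ x ∈ Λs n)
    (hlim : ∀ B : Finset V,
      Tendsto (fun n => isingCorr G (Λs n) β h .free B) atTop (𝓝 (spinCorr μ B)))
    (W : Finset V) (hWP : (↑W : Set V) ⊆ P) (F : SpinConfig V → ℝ) (hFm : Measurable F)
    (hFW : DependsOn F (↑W : Set V)) :
    0 ≤ ∫ τ, F (configReflect θ τ) * F τ ∂μ := by
  have hFb : ∃ C, ∀ σ, |F σ| ≤ C := by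
    classical
    let e : (↥W → ℤˣ) → SpinConfig V := fun η x => if hx : x ∈ W then η ⟨x, hx⟩ else 1
    obtain ⟨C, hC⟩ := Finite.exists_le fun η : ↥W → ℤˣ => |F (e η)|
    refine ⟨C, fun σ => ?_⟩
    have hσ : F σ = F (e fun x => σ x) := hFW fun x hx => by simp [e, Finset.mem_coe.1 hx]
    rw [hσ]
    exact hC fun x => σ ↑x
  refine integral_reflect_mul_self_nonneg_of_tendsto_isingCorr G θ Λs hlim hFW
    (Eventually.of_forall fun n => ?_)
  exact isingExpect_free_reflect_mul_self_nonneg_of_cross G θ hθ hθG (hΛs n) hP hcross hβ h hFm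
    (hFW.mono hWP) hFb

end Limit

end Literature.Probability.LatticeModels
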